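import Summits.Ventures.QEC.CircuitDistance.PortCoverFast
import HarnessLib

/-!
# P3-PORT (E7): COVERAGE FROM BASE COLUMNS — `covers₂`, a kernel-cheap coverage check (cell `qec`, experiment CDX,
# seat qec-cdx-type-1)

A single-fault column depends on the base index `i` only by translating the checks and on the cycle `c` only by shifting the
layers (plus the last-cycle flag `c + 1 ≤ Nc` on the `X` side): `colFormula k i c s j = baseF k (c+1 ≤ Nc) (s+1−c) (j − i)`.
So `covers₂` evaluates, per kind, the BASE LIST (`i = 0`, both flags) once and obtains every column by a `≤ 6`-element
map; word generators are matched through `candSet` (as `covers₁`); NULL columns (budget `≠ 0` only) are looked up in BUCKETS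
of the leaf's null coordinates keyed by the minimal encoded detector (all structural recursion — no well-founded sorting, which
the kernel cannot unfold).  Soundness `xcovers₂_sound` / `zcovers₂_sound : covers₂ = true → Fibre.Covers₀ …` feeds
`no_xLogical_of_leavesC` / `no_zLogical_of_leavesC` (`PortCoverFast`).
-/

namespace Summit.Ventures.QEC.CircuitDistance

open Literature.InformationTheory.QuantumCodes

variable {ℓ m : ℕ}

/-! ## Buckets of the leaf's null coordinates -/

/-- Minimum of a list below the default `M` (order-independent key). -/
def lmin (M : ℕ) (l : List ℕ) : ℕ := l.foldr min M

/-- Null coordinates of a leaf bucketed by the key of their coordinate lists. -/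
def Fibre.Leaf.nullBuckets (L : Fibre.Leaf) (M : ℕ) : List (List (Finset ℕ)) :=
  (List.range M).map fun b => L.nulls.filterMap fun c =>
    if lmin M (L.coordsOf c) = b then some (L.coordsOf c).toFinset else none

/-- A bucket entry is the coordinate set of a null coordinate. -/
theorem Fibre.Leaf.exists_null_of_mem_bucket (L : Fibre.Leaf) (M b : ℕ) {s : Finset ℕ}
    (h : s ∈ (L.nullBuckets M).getD b []) : ∃ c ∈ L.nulls, (L.coordsOf c).toFinset = s := by
  unfold Fibre.Leaf.nullBuckets at h
  rw [List.getD_eq_getElem?_getD, List.getElem?_map] at h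
  by_cases hb : b < M
  · rw [List.getElem?_range hb, Option.map_some, Option.getD_some, List.mem_filterMap] at h
    obtain ⟨c, hc, hcs⟩ := h
    refine ⟨c, hc, ?_⟩
    by_cases hk : lmin M (L.coordsOf c) = b
    · rw [if_pos hk, Option.some.injEq] at hcs; exact hcs
    · rw [if_neg hk] at hcs; exact absurd hcs (by simp)
  · rw [List.getElem?_eq_none (by rw [List.length_range]; omega)] at h
    exact absurd h List.not_mem_nil

section NZ

variable [NeZero ℓ] [NeZero m]

/-! ## Base formulas and base lists -/

/-- BASE FORMULA (`X`): the column of kind `k` at base index `0`, layer offset `d` (`s + 1 = c + d`), check `j₀`, with the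
not-last-cycle flag `nl = (c + 1 ≤ Nc)`. -/
def XTable.baseF (S : SMCode ℓ m) (T : XTable ℓ m) (k : XKind) (nl : Bool) (d : ℕ) (j₀ : BB.Mono ℓ m) : Bool :=
  let μ := decide (j₀ ∈ T.muZ k)
  let σ := synZ S (fun q => decide (q ∈ T.ex k)) j₀
  let ζ := decide (k = .initZ) && decide (j₀ = 0)
  xor (xor (decide (d = 0) && μ) (decide (d = 1) && xor (xor μ σ) (nl && ζ))) (decide (d = 2) && (nl && ζ))

/-- BASE LIST (`X`): the `(offset, check)` pairs of the base column. -/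
def XTable.baseList (S : SMCode ℓ m) (T : XTable ℓ m) (k : XKind) (nl : Bool) : List (ℕ × BB.Mono ℓ m) :=
  ((List.range 3).product (monoList ℓ m)).filter fun p => T.baseF S k nl p.1 p.2

/-- BASE FORMULA (`Z`): layer offset `d ∈ {0,1}` (`s + 1 = c + d`), check `i₀`; no cycle flag. -/
def ZTable.baseF (S : SMCode ℓ m) (T : ZTable ℓ m) (k : ZKind) (d : ℕ) (i₀ : BB.Mono ℓ m) : Bool :=
  let μ := decide (i₀ ∈ T.muX k)
  let σ := synX S (fun q => decide (q ∈ T.ez k)) i₀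
  xor (decide (d = 0) && μ) (decide (d = 1) && xor μ σ)

/-- BASE LIST (`Z`). -/
def ZTable.baseList (S : SMCode ℓ m) (T : ZTable ℓ m) (k : ZKind) : List (ℕ × BB.Mono ℓ m) :=
  ((List.range 2).product (monoList ℓ m)).filter fun p => T.baseF S k p.1 p.2

/-- The encoded column obtained from a base list by shifting layers to cycle `c0 + 1` and translating checks by `i`. -/
def keysOf (bl : List (ℕ × BB.Mono ℓ m)) (i : BB.Mono ℓ m) (c0 : ℕ) : List ℕ :=
  bl.map fun p => encDet (c0 + p.1, p.2 + i)

/-! ## Translation / shift identities -/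

/-- `synZ` of a translated support. -/
theorem synZ_trQ (S : SMCode ℓ m) (E : Finset (BB.Mono ℓ m ⊕ BB.Mono ℓ m)) (i j : BB.Mono ℓ m) :
    synZ S (fun q => decide (q ∈ trQ i E)) j = synZ S (fun q => decide (q ∈ E)) (j - i) := by
  unfold synZ
  have el : ∀ a : BB.Mono ℓ m, decide (Sum.inl (j - a) ∈ trQ i E) = decide ((Sum.inl (j - i - a) : _ ⊕ _) ∈ E) := by
    intro a; rw [decide_eq_decide, mem_trQ, translate_symm_inl]
    have : j - a + -i = j - i - a := by abel
    rw [this]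
  have er : ∀ a : BB.Mono ℓ m, decide (Sum.inr (j - a) ∈ trQ i E) = decide ((Sum.inr (j - i - a) : _ ⊕ _) ∈ E) := by
    intro a; rw [decide_eq_decide, mem_trQ, translate_symm_inr]
    have : j - a + -i = j - i - a := by abel
    rw [this]
  simp only [el, er]

/-- `synX` of a translated support. -/
theorem synX_trQ (S : SMCode ℓ m) (E : Finset (BB.Mono ℓ m ⊕ BB.Mono ℓ m)) (i i' : BB.Mono ℓ m) :
    synX S (fun q => decide (q ∈ trQ i E)) i' = synX S (fun q => decide (q ∈ E)) (i' - i) := by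
  unfold synX
  have el : ∀ a : BB.Mono ℓ m, decide (Sum.inl (i' + a) ∈ trQ i E) = decide ((Sum.inl (i' - i + a) : _ ⊕ _) ∈ E) := by
    intro a; rw [decide_eq_decide, mem_trQ, translate_symm_inl]
    have : i' + a + -i = i' - i + a := by abel
    rw [this]
  have er : ∀ a : BB.Mono ℓ m, decide (Sum.inr (i' + a) ∈ trQ i E) = decide ((Sum.inr (i' - i + a) : _ ⊕ _) ∈ E) := by
    intro a; rw [decide_eq_decide, mem_trQ, translate_symm_inr]
    have : i' + a + -i = i' - i + a := by abel
    rw [this]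
  simp only [el, er]

/-- The `X` column formula is the shifted/translated base formula. -/
theorem XTable.colFormula_base (S : SMCode ℓ m) (T : XTable ℓ m) (Nc : ℕ) (k : XKind) (i : BB.Mono ℓ m) {c s d : ℕ}
    (hd : s + 1 = c + d) (j : BB.Mono ℓ m) :
    T.colFormula S Nc k i c s j = T.baseF S k (decide (c + 1 ≤ Nc)) d (j - i) := by
  unfold XTable.colFormula XTable.baseF
  have e0 : decide (s + 1 = c) = decide (d = 0) := decide_eq_decide.mpr (by omega)
  have e1 : decide (s + 1 = c + 1) = decide (d = 1) := decide_eq_decide.mpr (by omega)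
  have e2 : decide (s + 1 = c + 2) = decide (d = 2) := decide_eq_decide.mpr (by omega)
  have ez : decide (j = i) = decide (j - i = 0) := decide_eq_decide.mpr sub_eq_zero.symm
  simp only [e0, e1, e2, ez, synZ_trQ]

/-- The `Z` column formula is the shifted/translated base formula. -/
theorem ZTable.colFormula_base (S : SMCode ℓ m) (T : ZTable ℓ m) (k : ZKind) (i : BB.Mono ℓ m) {c s d : ℕ}
    (hd : s + 1 = c + d) (i' : BB.Mono ℓ m) :
    T.colFormula S k i c s i' = T.baseF S k d (i' - i) := by
  unfold ZTable.colFormula ZTable.baseF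
  have e0 : decide (s + 1 = c) = decide (d = 0) := decide_eq_decide.mpr (by omega)
  have e1 : decide (s + 1 = c + 1) = decide (d = 1) := decide_eq_decide.mpr (by omega)
  simp only [e0, e1, synX_trQ]

/-- **`X` columns from the base list.** -/
theorem XTable.keysOf_baseList (S : SMCode ℓ m) (T : XTable ℓ m) (Nc : ℕ) (k : XKind) (i : BB.Mono ℓ m) (c0 : ℕ) :
    (keysOf (T.baseList S k (decide (c0 + 1 + 1 ≤ Nc))) i c0).toFinset = (T.detFast S Nc k i (c0 + 1)).image encDet := by
  ext v
  rw [List.mem_toFinset, Finset.mem_image]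
  unfold keysOf XTable.baseList
  rw [List.mem_map]
  constructor
  · rintro ⟨⟨d, j₀⟩, hp, rfl⟩
    rw [List.mem_filter, List.pair_mem_product, List.mem_range] at hp
    obtain ⟨⟨hd, -⟩, hf⟩ := hp
    refine ⟨(c0 + d, j₀ + i), ?_, rfl⟩
    unfold XTable.detFast
    rw [Finset.mem_filter, Finset.mem_product]
    refine ⟨⟨?_, Finset.mem_univ _⟩, ?_⟩
    · simp only [Finset.mem_insert, Finset.mem_singleton]; omega
    · rw [T.colFormula_base S Nc k i (d := d) (by omega), add_sub_cancel_right]; exact hf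
  · rintro ⟨⟨s, j⟩, hp, rfl⟩
    unfold XTable.detFast at hp
    rw [Finset.mem_filter, Finset.mem_product] at hp
    obtain ⟨⟨hs, -⟩, hf⟩ := hp
    simp only [Finset.mem_insert, Finset.mem_singleton] at hs
    have hsd : s + 1 = c0 + 1 + (s - c0) := by omega
    refine ⟨(s - c0, j - i), ?_, ?_⟩
    · rw [List.mem_filter, List.pair_mem_product, List.mem_range]
      refine ⟨⟨by omega, mem_monoList _⟩, ?_⟩
      rw [← T.colFormula_base S Nc k i hsd]; exact hf
    · show encDet (c0 + (s - c0), j - i + i) = encDet (s, j)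
      rw [sub_add_cancel]; congr 2; omega

/-- **`Z` columns from the base list.** -/
theorem ZTable.keysOf_baseList (S : SMCode ℓ m) (T : ZTable ℓ m) (k : ZKind) (i : BB.Mono ℓ m) (c0 : ℕ) :
    (keysOf (T.baseList S k) i c0).toFinset = (T.detFast S k i (c0 + 1)).image encDet := by
  ext v
  rw [List.mem_toFinset, Finset.mem_image]
  unfold keysOf ZTable.baseList
  rw [List.mem_map]
  constructor
  · rintro ⟨⟨d, j₀⟩, hp, rfl⟩
    rw [List.mem_filter, List.pair_mem_product, List.mem_range] at hp
    obtain ⟨⟨hd, -⟩, hf⟩ := hp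
    refine ⟨(c0 + d, j₀ + i), ?_, rfl⟩
    unfold ZTable.detFast
    rw [Finset.mem_filter, Finset.mem_product]
    refine ⟨⟨?_, Finset.mem_univ _⟩, ?_⟩
    · simp only [Finset.mem_insert, Finset.mem_singleton]; omega
    · rw [T.colFormula_base S k i (d := d) (by omega), add_sub_cancel_right]; exact hf
  · rintro ⟨⟨s, j⟩, hp, rfl⟩
    unfold ZTable.detFast at hp
    rw [Finset.mem_filter, Finset.mem_product] at hp
    obtain ⟨⟨hs, -⟩, hf⟩ := hp
    simp only [Finset.mem_insert, Finset.mem_singleton] at hs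
    have hsd : s + 1 = c0 + 1 + (s - c0) := by omega
    refine ⟨(s - c0, j - i), ?_, ?_⟩
    · rw [List.mem_filter, List.pair_mem_product, List.mem_range]
      refine ⟨⟨by omega, mem_monoList _⟩, ?_⟩
      rw [← T.colFormula_base S k i hsd]; exact hf
    · show encDet (c0 + (s - c0), j - i + i) = encDet (s, j)
      rw [sub_add_cancel]; congr 2; omega

/-! ## The checks -/

/-- Null-column lookup of one encoded column in the buckets (`true` for the empty column). -/
def nullHit (bk : List (List (Finset ℕ))) (M : ℕ) (ks : List ℕ) : Bool :=
  ks.isEmpty || (bk.getD (lmin M ks) []).any fun s => decide (s = ks.toFinset)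

/-- What a hit means. -/
theorem nullHit_sound (L : Fibre.Leaf) (M : ℕ) (ks : List ℕ) (h : nullHit (L.nullBuckets M) M ks = true) :
    ks.toFinset = ∅ ∨ ∃ c ∈ L.nulls, (L.coordsOf c).toFinset = ks.toFinset := by
  unfold nullHit at h
  rw [Bool.or_eq_true] at h
  rcases h with h | h
  · left; rw [List.isEmpty_iff] at h; rw [h]; rfl
  · right
    rw [List.any_eq_true] at h
    obtain ⟨s, hs, hse⟩ := h
    rw [decide_eq_true_eq] at hse
    obtain ⟨c, hc, hcs⟩ := L.exists_null_of_mem_bucket M _ hs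
    exact ⟨c, hc, by rw [hcs, hse]⟩

/-- The bucket bound (encoded detectors of the circuits considered stay below it; larger keys merely fail). -/
def bucketBound : ℕ := 4096

/-- COVERAGE CHECK FROM BASE COLUMNS (`X`). -/
def XTable.covers₂ (S : SMCode ℓ m) (T : XTable ℓ m) (Nc : ℕ) (e : LeafEntry ℓ m) : Bool :=
  let bases := XKind.all.map fun k => (k, T.baseList S k true, T.baseList S k false)
  let bk := e.leaf.nullBuckets bucketBound
  decide (e.word.length = e.leaf.k) &&
  ((List.range e.word.length).all fun j => bases.all fun kb =>
    match T.cls kb.1 with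
    | none => true
    | some g₀ => decide (∀ i ∈ candSet g₀ (e.word.getD j ∅), trQ i g₀ = e.word.getD j ∅ →
        ∀ c0 < Nc, ∃ c ∈ e.leaf.group j, (e.leaf.coordsOf c).toFinset =
          (keysOf (if c0 + 1 + 1 ≤ Nc then kb.2.1 else kb.2.2) i c0).toFinset)) &&
  (decide (e.leaf.budget = 0) || bases.all fun kb =>
    match T.cls kb.1 with
    | some _ => true
    | none => (monoList ℓ m).all fun i => (List.range Nc).all fun c0 =>
        nullHit bk bucketBound (keysOf (if c0 + 1 + 1 ≤ Nc then kb.2.1 else kb.2.2) i c0))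

/-- COVERAGE CHECK FROM BASE COLUMNS (`Z`). -/
def ZTable.covers₂ (S : SMCode ℓ m) (T : ZTable ℓ m) (Nc : ℕ) (e : LeafEntry ℓ m) : Bool :=
  let bases := ZKind.all.map fun k => (k, T.baseList S k)
  let bk := e.leaf.nullBuckets bucketBound
  decide (e.word.length = e.leaf.k) &&
  ((List.range e.word.length).all fun j => bases.all fun kb =>
    match T.cls kb.1 with
    | none => true
    | some g₀ => decide (∀ i ∈ candSet g₀ (e.word.getD j ∅), trQ i g₀ = e.word.getD j ∅ →
        ∀ c0 < Nc, ∃ c ∈ e.leaf.group j, (e.leaf.coordsOf c).toFinset = (keysOf kb.2 i c0).toFinset)) &&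
  (decide (e.leaf.budget = 0) || bases.all fun kb =>
    match T.cls kb.1 with
    | some _ => true
    | none => (monoList ℓ m).all fun i => (List.range Nc).all fun c0 => nullHit bk bucketBound (keysOf kb.2 i c0))

/-! ## Soundness -/

/-- The flagged base list is the right one. -/
theorem XTable.keysOf_ite (S : SMCode ℓ m) (T : XTable ℓ m) (Nc : ℕ) (k : XKind) (i : BB.Mono ℓ m) (c0 : ℕ) :
    (keysOf (if c0 + 1 + 1 ≤ Nc then T.baseList S k true else T.baseList S k false) i c0).toFinset =
      (T.detFast S Nc k i (c0 + 1)).image encDet := by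
  rw [← T.keysOf_baseList S Nc k i c0]
  by_cases h : c0 + 1 + 1 ≤ Nc
  · rw [if_pos h, decide_eq_true h]
  · rw [if_neg h, decide_eq_false h]

/-- **Soundness of `covers₂`** (`X`). -/
theorem xcovers₂_sound (S : SMCode ℓ m) (T : XTable ℓ m) (hS : T.ShapeCorrect S) (Nc : ℕ) (e : LeafEntry ℓ m)
    (h : T.covers₂ S Nc e = true) : Fibre.Covers₀ (xDEM S T Nc) (scope Nc) encDet e.word e.leaf := by
  unfold XTable.covers₂ at h
  simp only [Bool.and_eq_true, decide_eq_true_eq, List.all_eq_true, List.mem_range, Bool.or_eq_true, List.mem_map,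
    forall_exists_index, and_imp] at h
  obtain ⟨⟨hlen, hall⟩, hnull⟩ := h
  refine ⟨encDet_injective, hlen, fun f hf j hcls => ?_, ?_⟩
  · obtain ⟨h₁, h₂⟩ := hf
    change (f.xKind.bind fun ki => (T.cls ki.1).map (trQ ki.2)) = some e.word[j] at hcls
    rcases hk : f.xKind with _ | ⟨k, i⟩
    · rw [hk] at hcls; simp at hcls
    · rw [hk, Option.bind_some] at hcls
      have hkall : k ∈ XKind.all := XKind.mem_all k (fun lay => Fault.xKind_ne_zero hk lay)
      have hjk := hall j j.2 _ k hkall rfl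
      rcases hc : T.cls k with _ | g₀
      · rw [hc] at hcls; simp at hcls
      · simp only [hc] at hcls hjk
        simp only [Option.map_some, Option.some.injEq] at hcls
        rw [decide_eq_true_eq] at hjk
        have hwd : e.word.getD (j : ℕ) ∅ = e.word[j] := List.getD_eq_getElem _ _ j.2
        rw [hwd] at hjk
        obtain ⟨c, hc', hcc⟩ := hjk i (mem_candSet hcls) hcls (f.cyc - 1) (by omega)
        refine ⟨c, hc', ?_⟩
        rw [hcc, T.keysOf_ite S Nc k i, Nat.sub_add_cancel h₁, XTable.detFast_eq_xDet (hS k hkall) Nc i f.cyc h₁ h₂,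
          ← xDet_eq_of_xKind S Nc f hk]
        rfl
  · by_cases hb : e.leaf.budget = 0
    · exact Or.inl hb
    · refine Or.inr fun f hf hcls => ?_
      rcases hnull with hnull | hnull
      · exact absurd hnull hb
      obtain ⟨h₁, h₂⟩ := hf
      change (f.xKind.bind fun ki => (T.cls ki.1).map (trQ ki.2)) = none at hcls
      rcases hk : f.xKind with _ | ⟨k, i⟩
      · exact Or.inl (xDet_eq_empty_of_xKind S Nc f hk)
      · rw [hk, Option.bind_some] at hcls
        have hkall : k ∈ XKind.all := XKind.mem_all k (fun lay => Fault.xKind_ne_zero hk lay)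
        have hcn : T.cls k = none := by
          rcases hc : T.cls k with _ | g₀
          · rfl
          · rw [hc] at hcls; simp at hcls
        have hki := hnull _ k hkall rfl
        simp only [hcn] at hki
        rw [List.all_eq_true] at hki
        have hi := hki i (mem_monoList i)
        rw [List.all_eq_true] at hi
        have hc0 := hi (f.cyc - 1) (List.mem_range.2 (by omega))
        have hcol : (T.detFast S Nc k i (f.cyc - 1 + 1)).image encDet = (xDet S Nc f).image encDet := by
          rw [Nat.sub_add_cancel h₁, XTable.detFast_eq_xDet (hS k hkall) Nc i f.cyc h₁ h₂, ← xDet_eq_of_xKind S Nc f hk]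
        rcases nullHit_sound e.leaf _ _ hc0 with h0 | ⟨c, hcn', hcc⟩
        · left
          rw [T.keysOf_ite S Nc k i, hcol, Finset.image_eq_empty] at h0; exact h0
        · right
          exact ⟨c, hcn', by rw [hcc, T.keysOf_ite S Nc k i, hcol]; rfl⟩

/-- **Soundness of `covers₂`** (`Z`). -/
theorem zcovers₂_sound (S : SMCode ℓ m) (T : ZTable ℓ m) (hS : T.ShapeCorrect S) (Nc : ℕ) (e : LeafEntry ℓ m)
    (h : T.covers₂ S Nc e = true) : Fibre.Covers₀ (zDEM S T Nc) (scope Nc) encDet e.word e.leaf := by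
  unfold ZTable.covers₂ at h
  simp only [Bool.and_eq_true, decide_eq_true_eq, List.all_eq_true, List.mem_range, Bool.or_eq_true, List.mem_map,
    forall_exists_index, and_imp] at h
  obtain ⟨⟨hlen, hall⟩, hnull⟩ := h
  refine ⟨encDet_injective, hlen, fun f hf j hcls => ?_, ?_⟩
  · obtain ⟨h₁, h₂⟩ := hf
    change (f.zKind.bind fun ki => (T.cls ki.1).map (trQ ki.2)) = some e.word[j] at hcls
    rcases hk : f.zKind with _ | ⟨k, i⟩
    · rw [hk] at hcls; simp at hcls
    · rw [hk, Option.bind_some] at hcls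
      have hkall : k ∈ ZKind.all := ZKind.mem_all k (fun lay => Fault.zKind_ne_zero hk lay)
      have hjk := hall j j.2 _ k hkall rfl
      rcases hc : T.cls k with _ | g₀
      · rw [hc] at hcls; simp at hcls
      · simp only [hc] at hcls hjk
        simp only [Option.map_some, Option.some.injEq] at hcls
        rw [decide_eq_true_eq] at hjk
        have hwd : e.word.getD (j : ℕ) ∅ = e.word[j] := List.getD_eq_getElem _ _ j.2
        rw [hwd] at hjk
        obtain ⟨c, hc', hcc⟩ := hjk i (mem_candSet hcls) hcls (f.cyc - 1) (by omega)
        refine ⟨c, hc', ?_⟩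
        rw [hcc, T.keysOf_baseList S k i, Nat.sub_add_cancel h₁, ZTable.detFast_eq_zDet (hS k hkall) Nc i f.cyc h₁ h₂,
          ← zDet_eq_of_zKind S Nc f hk]
        rfl
  · by_cases hb : e.leaf.budget = 0
    · exact Or.inl hb
    · refine Or.inr fun f hf hcls => ?_
      rcases hnull with hnull | hnull
      · exact absurd hnull hb
      obtain ⟨h₁, h₂⟩ := hf
      change (f.zKind.bind fun ki => (T.cls ki.1).map (trQ ki.2)) = none at hcls
      rcases hk : f.zKind with _ | ⟨k, i⟩
      · exact Or.inl (zDet_eq_empty_of_zKind S Nc f hk)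
      · rw [hk, Option.bind_some] at hcls
        have hkall : k ∈ ZKind.all := ZKind.mem_all k (fun lay => Fault.zKind_ne_zero hk lay)
        have hcn : T.cls k = none := by
          rcases hc : T.cls k with _ | g₀
          · rfl
          · rw [hc] at hcls; simp at hcls
        have hki := hnull _ k hkall rfl
        simp only [hcn] at hki
        rw [List.all_eq_true] at hki
        have hi := hki i (mem_monoList i)
        rw [List.all_eq_true] at hi
        have hc0 := hi (f.cyc - 1) (List.mem_range.2 (by omega))
        have hcol : (T.detFast S k i (f.cyc - 1 + 1)).image encDet = (zDet S Nc f).image encDet := by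
          rw [Nat.sub_add_cancel h₁, ZTable.detFast_eq_zDet (hS k hkall) Nc i f.cyc h₁ h₂, ← zDet_eq_of_zKind S Nc f hk]
        rcases nullHit_sound e.leaf _ _ hc0 with h0 | ⟨c, hcn', hcc⟩
        · left
          rw [T.keysOf_baseList S k i, hcol, Finset.image_eq_empty] at h0; exact h0
        · right
          exact ⟨c, hcn', by rw [hcc, T.keysOf_baseList S k i, hcol]; rfl⟩

end NZ

end Summit.Ventures.QEC.CircuitDistance
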